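import Summits.BirchSwinnertonDyer.BirchSwinnertonDyer.Theorems.RamifiedHeegnerPairLeafPartnerGZShapeShaAn
import HarnessLib

/-!
# Route `RamifiedHeegnerPair`, crux U₁ `LeafRankOneUpperAtThree` (stmt-BirchSwinnertonDyer-26022), line `partnerdescent` —
# the (GZ-Sh₀) conjunct from a REAL Gross–Zagier display with FREE period-degree constants (part 2b of the partner kernel)

HONEST FRAMING. Theorems only; helper file (`--supports stmt-BirchSwinnertonDyer-26022 --as helper`); no definition, no named
fact, no `sorry`; nothing booked, no item closed; CONDITIONAL on every displayed input; BSD is proved for no curve. Lead prover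
bsd-line-rhp-p2 g55, 2026-08-30. Sequel of `…LeafPartnerGZShapeShaAn.lean` (same seat): X11b's `gzShape₀_of_shimuraGZReal`
VERBATIM with the two period-degree constants `(dC, cM)` FREE (on the partner road they are the modular degree and Manin constant
of the `3`-good twist partner's optimal datum, while the lattice, `Ш`, torsion and `L`-values are the leaf curve's), plus the
non-torsion of a point carrying a real display.

* `gzShape₀_of_realDisplay` — `2·ord_p[E(K):ℤP] + ord_p dC = ord_p q_E + ord_p q_d + ord_p degS`, `q_E = L′(E,1)/(Ω_E Reg_E)`.
* `not_isOfFinAddOrder_of_realDisplay` — a point carrying a real display on an `r_an = 1` curve with `L(E^{d_K},1) ≠ 0` is not torsion.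
-- adapted from Summits/BirchSwinnertonDyer/Rank1Residual/X11b/BDPRouteUpperGZRealShape.lean (verbatim, two constants freed)

References: [cite: CaiShuTian2014, Thm. 1.1 and Thm. 1.5] [cite: JetchevSkinnerWan2017, §7.4.2 (pp. 30–31)] [cite: Miller2011LMS, Def. 1.1]
[cite: ZagierCMB1985, §1, p. 374]. presearch: n/a (port of tree theorems).
-/

noncomputable section

open scoped Classical

open WeierstrassCurve NumberField Literature.NumberTheory.EllipticCurves
  Literature.NumberTheory.EllipticCurves.ModularForms
  Literature.NumberTheory.EllipticCurves.Rank1Residual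
  Literature.NumberTheory.EllipticCurves.KrizLi2019
  Literature.NumberTheory.QuadraticFields
  Summit.BirchSwinnertonDyer.Rank1Residual.X11b

-- D-0017: single-problem summit, so `Summit.BirchSwinnertonDyer.BirchSwinnertonDyer.…` repeats a namespace BY DESIGN.
set_option linter.dupNamespace false
set_option autoImplicit false

namespace Summit.BirchSwinnertonDyer.BirchSwinnertonDyer.Theorems.LeafPartnerGZShape

/-! ## §1 The (GZ-Sh₀) conjunct -/

/-- **(GZ-Sh₀) from a real display with free constants.** X11b's `gzShape₀_of_shimuraGZReal` VERBATIM over §1: with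
`q_E := L′(E,1)/(Ω_E·Reg_E)` and `q_d := L(E^{d_K},1)/Ω_{E^{d_K}}` (non-zero),
`2·ord_p[E(K):ℤP] + ord_p dC = ord_p q_E + ord_p q_d + ord_p degS`, given `p ∤ #E(ℚ)_tors`, `p ∤ #E^{d_K}(ℚ)_tors`.
CONDITIONAL on the display; nothing booked. [cite: CaiShuTian2014, Thm. 1.1 and Thm. 1.5] [cite: JetchevSkinnerWan2017, §7.4.2]
[cite: Miller2011LMS, Def. 1.1] -/
theorem gzShape₀_of_realDisplay
    (W : WeierstrassCurve ℚ) [W.IsElliptic] [W.IsGloballyMinimal] (p : ℕ) [Fact p.Prime]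
    (N : ℕ) [NeZero N] (K : Type) [Field K] [NumberField K]
    (Dt : ModularParametrizationData W N) (P : (W.baseChange K).toAffine.Point) (degS : ℕ)
    (dC : ℕ) (cM : ℤ)
    (hGZK : rank_eq_analyticRank_of_analyticRank_le_one) (hmod : hasEntireLFunction_rat)
    (hK : IsImaginaryQuadratic K) (hp2 : p ≠ 2) (hc : ¬ (p : ℤ) ∣ cM)
    (hμ : ¬ p ∣ Units.torsionOrder K) (hr : W.analyticRank = 1)
    (hLt : (W.quadraticTwist (NumberField.discr K : ℚ)).entireLFunction 1 ≠ 0)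
    (hdegS : 0 < degS)
    (hGZR : (degS : ℂ) * LDerivEK W K =
      ((2 * ZLattice.covolume Dt.L.lattice * (dC : ℝ) /
          ((cM : ℝ) ^ 2 * ((Units.torsionOrder K : ℝ) / 2) ^ 2 * √|(NumberField.discr K : ℝ)|) *
        P.canonicalHeight : ℝ) : ℂ))
    (Wd : WeierstrassCurve ℚ) [Wd.IsElliptic] [Wd.IsGloballyMinimal] (Cd : VariableChange ℚ)
    (hWd : Cd • W.quadraticTwist (NumberField.discr K : ℚ) = Wd)
    (hu : padicValRat p (Cd.u : ℚ) = 0)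
    (qd : ℚ) (hqd : Wd.entireLFunction 1 / (Wd.realPeriodRat : ℂ) = (qd : ℂ))
    (htW : ¬ p ∣ W.torsionOrder) (htd : ¬ p ∣ Wd.torsionOrder) :
    ∃ qE : ℚ, qE ≠ 0 ∧ qd ≠ 0 ∧
      W.leadingLCoeff / ((W.realPeriodRat : ℂ) * (W.regulator : ℂ)) = (qE : ℂ) ∧
      (2 * padicValNat p (AddSubgroup.zmultiples P).index : ℤ) + padicValNat p dC =
        padicValRat p qE + padicValRat p qd + padicValNat p degS := by
  have hpp : p.Prime := Fact.out
  have hD0 : (NumberField.discr K : ℚ) ≠ 0 := by exact_mod_cast NumberField.discr_ne_zero K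
  haveI hEt : (W.quadraticTwist (NumberField.discr K : ℚ)).IsElliptic :=
    W.isElliptic_quadraticTwist hD0
  obtain ⟨-, -, -, q, hq, hval⟩ := exists_shaAn_padicVal_eq_of_realDisplay W p N K Dt P degS dC cM
    hGZK hmod hK hp2 hc hμ hr hLt hdegS hGZR Wd Cd hWd hu qd hqd
  -- positivity
  have hcW : 0 < W.tamagawaProduct := W.tamagawaProduct_pos_holds
  have htW0 : 0 < W.torsionOrder := W.torsionOrder_pos_holds
  have hΩW : 0 < W.realPeriodRat := W.realPeriodRat_pos_holds
  have hR : 0 < W.regulator := W.regulator_pos'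
  have hcW' : (W.tamagawaProduct : ℚ) ≠ 0 := by exact_mod_cast hcW.ne'
  have htW' : (W.torsionOrder : ℚ) ≠ 0 := by exact_mod_cast htW0.ne'
  -- `q ≠ 0` and `qd ≠ 0` from `shaAn W ≠ 0` (`L′(E,1) ≠ 0`)
  obtain ⟨hlead, hderiv⟩ := leadingLCoeff_eq_deriv_of_analyticRank_eq_one hr
  have hleadne : W.leadingLCoeff ≠ 0 := by rw [hlead]; exact hderiv
  have hΩC : (W.realPeriodRat : ℂ) ≠ 0 := by exact_mod_cast hΩW.ne'
  have hRC : (W.regulator : ℂ) ≠ 0 := by exact_mod_cast hR.ne'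
  have hcC : (W.tamagawaProduct : ℂ) ≠ 0 := by exact_mod_cast hcW.ne'
  have htC : (W.torsionOrder : ℂ) ≠ 0 := by exact_mod_cast htW0.ne'
  have hq0 : q ≠ 0 := by
    intro h0
    have : shaAn W = 0 := by rw [hq, h0]; simp
    rw [shaAn_def] at this
    exact (div_ne_zero (mul_ne_zero hleadne (pow_ne_zero _ htC))
      (mul_ne_zero (mul_ne_zero hΩC hcC) hRC)) this
  have hLt' : (W.quadraticTwist (NumberField.discr K : ℚ)).entireLFunction = Wd.entireLFunction := by
    rw [← hWd, entireLFunction_smul]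
  have hΩdC : (Wd.realPeriodRat : ℂ) ≠ 0 := by exact_mod_cast (Wd.realPeriodRat_pos_holds).ne'
  have hqd0 : qd ≠ 0 := by
    intro h0
    have h1 : Wd.entireLFunction 1 = 0 := by
      have := (div_eq_iff hΩdC).mp hqd
      rw [this, h0]; simp
    exact hLt (by rw [hLt']; exact h1)
  -- `qE := q · ∏c / t²`
  refine ⟨q * W.tamagawaProduct / (W.torsionOrder : ℚ) ^ 2,
    div_ne_zero (mul_ne_zero hq0 hcW') (pow_ne_zero _ htW'), hqd0, ?_, ?_⟩
  · -- `leadingLCoeff/(Ω·Reg) = shaAn · ∏c / t²`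
    have hsha := hq
    rw [shaAn_def] at hsha
    have : W.leadingLCoeff / ((W.realPeriodRat : ℂ) * (W.regulator : ℂ)) =
        shaAn W * (W.tamagawaProduct : ℂ) / (W.torsionOrder : ℂ) ^ 2 := by
      rw [shaAn_def]; field_simp
    rw [this, hq]; push_cast; ring
  · have hvt : padicValNat p W.torsionOrder = 0 := padicValNat.eq_zero_of_not_dvd htW
    have hvtd : padicValNat p Wd.torsionOrder = 0 := padicValNat.eq_zero_of_not_dvd htd
    have hvqE : padicValRat p (q * W.tamagawaProduct / (W.torsionOrder : ℚ) ^ 2) =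
        padicValRat p q + padicValNat p W.tamagawaProduct := by
      rw [padicValRat.div (mul_ne_zero hq0 hcW') (pow_ne_zero _ htW'), padicValRat.mul hq0 hcW',
        padicValRat.pow, padicValRat.of_nat, padicValRat.of_nat, hvt]
      push_cast; ring
    rw [hvqE]
    rw [hvtd] at hval
    push_cast at hval ⊢
    linarith


/-! ## §2 Non-torsion from a real display -/

/-- **Non-torsion from a real display.** For `W` with `ord_{s=1} L(E,s) = 1` and a quadratic field `K` with `L(E^{d_K},1) ≠ 0`,
`L′(E/K,1) = L′(E,1)·L(E^{d_K},1) ≠ 0` (modularity, product rule); so a point `P ∈ E(K)` with `degS · L′(E/K,1) = C · ĥ_K(P)`,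
`degS ≥ 1`, is not torsion (`ĥ_K(P) = 0` for torsion `P`). [folklore] -/
theorem not_isOfFinAddOrder_of_realDisplay
    (hmod : hasEntireLFunction_rat)
    (W : WeierstrassCurve ℚ) [W.IsElliptic] (K : Type) [Field K] [NumberField K]
    (hr : W.analyticRank = 1)
    (hLt : (W.quadraticTwist (NumberField.discr K : ℚ)).entireLFunction 1 ≠ 0)
    (P : (W.baseChange K).toAffine.Point) {degS : ℕ} (hdegS : 0 < degS) (C : ℝ)
    (hGZR : (degS : ℂ) * LDerivEK W K = ((C * P.canonicalHeight : ℝ) : ℂ)) : ¬ IsOfFinAddOrder P := by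
  haveI hEK : (W.baseChange K).IsElliptic := by rw [WeierstrassCurve.baseChange]; infer_instance
  have hL0 : W.entireLFunction 1 = 0 := entireLFunction_one_eq_zero_of_analyticRank_eq_one hr
  obtain ⟨-, hderiv⟩ := leadingLCoeff_eq_deriv_of_analyticRank_eq_one hr
  have hLK : LDerivEK W K ≠ 0 := by
    rw [lDerivEK_eq_deriv_mul W K hmod hL0]
    exact mul_ne_zero hderiv hLt
  have hdegSC : (degS : ℂ) ≠ 0 := by exact_mod_cast hdegS.ne'
  intro htor
  have h0 : P.canonicalHeight = 0 :=
    (WeierstrassCurve.Affine.Point.canonicalHeight_eq_zero_iff_holds P).mpr htor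
  have : (degS : ℂ) * LDerivEK W K = 0 := by rw [hGZR, h0]; simp
  exact (mul_ne_zero hdegSC hLK) this

end Summit.BirchSwinnertonDyer.BirchSwinnertonDyer.Theorems.LeafPartnerGZShape

end
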